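import Summits.CriticalPhenomena.CardyFormulaZ2.Theorems.CardyGluingRDEBoxMergingArcUnions

/-!
# `CardyGluingRDE.BoxMerging` ⇒ the crossing events of every dyadic-marked square merge
# (stmt-CriticalPhenomena-8582)

Third file on the consequence direction of the route item `BoxMerging` (sub-problem
`CardyFormulaZ2`, route `CardyGluingRDE`), after `CardyGluingRDEBoxMergingSquareCardy.lean`
(Cardy's formula for the corner-marked square on `ℤ²`) and `CardyGluingRDEBoxMergingArcUnions.lean`
(crossings between unions of boundary pieces are read from the state law, on both lattices).
Here the window is the route's square `(0, δ₀)²` with its `4·2^j` dyadic boundary segments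
`seg δ₀ j a` (route notation, inlined verbatim):

* `BoxMerging_seg_nonempty` — every segment is nonempty;
* `BoxMerging_frontier_sq` — `∂Sq` is the union of the four closed sides;
* `BoxMerging_index_eq_of_mid`, `BoxMerging_exists_mem_frontier_mem_seg_unique`,
  `BoxMerging_frontier_diff_biUnion_seg_nonempty` — the midpoint of a segment lies on `∂Sq` and in
  no other segment, so a proper union of segments leaves out part of `∂Sq` (the nonemptiness
  hypothesis of the `infDist` bookkeeping `discreteArc_union`);
* `BoxMerging_unions_merge` — **consequence of `BoxMerging`**: for every `δ₀ > 0`, resolution `j`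
  and `ε > 0` there is `η > 0` such that for all meshes `0 < u, u' < η` and all nonempty proper
  index sets `I, J` of segments, the bond-`ℤ²` and site-`𝕋` probabilities of an open crossing of
  the square from `⋃_I seg` to `⋃_J seg` differ by at most `ε` — the crossing events of every
  dyadic-marked square, as announced by the item's informal statement ("implies LimitExists for
  every dyadic-marked square on `ℤ²` since the `𝕋` side converges").
-/

noncomputable section

namespace Summit.CriticalPhenomena.CardyFormulaZ2.Theorems

open scoped BigOperators Topology
open Filter Set MeasureTheory
open Literature.Probability.Percolation Literature.Probability.RandomPlanarGeometry
  Literature.Probability.LatticeModels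
open Summit.CriticalPhenomena.CardyFormulaZ2.Theses.CardyGluingRDE

/-! ### The square window and its dyadic segments -/


/-- Every dyadic boundary segment `seg δ₀ j a` of the square (route notation) is nonempty: it
contains its first endpoint. [folklore] -/
theorem BoxMerging_seg_nonempty {δ₀ : ℝ} (hδ₀ : 0 < δ₀) (j : ℕ) (a : Fin 4 × Fin (2 ^ j)) :
    {z : ℂ | (a.1 = 0 ∧ z.im = 0 ∧ δ₀ * ((a.2 : ℕ) : ℝ) / 2 ^ j ≤ z.re ∧
          z.re ≤ δ₀ * (((a.2 : ℕ) : ℝ) + 1) / 2 ^ j) ∨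
        (a.1 = 1 ∧ z.re = δ₀ ∧ δ₀ * ((a.2 : ℕ) : ℝ) / 2 ^ j ≤ z.im ∧
          z.im ≤ δ₀ * (((a.2 : ℕ) : ℝ) + 1) / 2 ^ j) ∨
        (a.1 = 2 ∧ z.im = δ₀ ∧ δ₀ * ((a.2 : ℕ) : ℝ) / 2 ^ j ≤ z.re ∧
          z.re ≤ δ₀ * (((a.2 : ℕ) : ℝ) + 1) / 2 ^ j) ∨
        (a.1 = 3 ∧ z.re = 0 ∧ δ₀ * ((a.2 : ℕ) : ℝ) / 2 ^ j ≤ z.im ∧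
          z.im ≤ δ₀ * (((a.2 : ℕ) : ℝ) + 1) / 2 ^ j)}.Nonempty := by
  have hle : δ₀ * ((a.2 : ℕ) : ℝ) / 2 ^ j ≤ δ₀ * (((a.2 : ℕ) : ℝ) + 1) / 2 ^ j :=
    div_le_div_of_nonneg_right (by nlinarith) (by positivity)
  obtain ⟨s, t⟩ := a
  fin_cases s
  · exact ⟨⟨δ₀ * ((t : ℕ) : ℝ) / 2 ^ j, 0⟩, Or.inl ⟨rfl, rfl, le_rfl, hle⟩⟩
  · exact ⟨⟨δ₀, δ₀ * ((t : ℕ) : ℝ) / 2 ^ j⟩, Or.inr (Or.inl ⟨rfl, rfl, le_rfl, hle⟩)⟩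
  · exact ⟨⟨δ₀ * ((t : ℕ) : ℝ) / 2 ^ j, δ₀⟩, Or.inr (Or.inr (Or.inl ⟨rfl, rfl, le_rfl, hle⟩))⟩
  · exact ⟨⟨0, δ₀ * ((t : ℕ) : ℝ) / 2 ^ j⟩, Or.inr (Or.inr (Or.inr ⟨rfl, rfl, le_rfl, hle⟩))⟩

/-- The frontier of the square window `(0, δ₀)²` consists of its four closed sides. [folklore] -/
theorem BoxMerging_frontier_sq {δ₀ : ℝ} (hδ₀ : 0 < δ₀) :
    frontier {z : ℂ | 0 < z.re ∧ z.re < δ₀ ∧ 0 < z.im ∧ z.im < δ₀} =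
      Icc 0 δ₀ ×ℂ {0, δ₀} ∪ {0, δ₀} ×ℂ Icc 0 δ₀ := by
  rw [BoxMerging_sq_eq_rectQuad_carrier hδ₀, rectQuad_carrier, Complex.frontier_reProdIm,
    closure_Ioo hδ₀.ne, frontier_Ioo hδ₀]

/-- Dyadic bookkeeping: if the midpoint parameter `t + ½` of the `t`-th dyadic piece lies in the
`t'`-th closed dyadic piece, then `t' = t`. [folklore] -/
theorem BoxMerging_index_eq_of_mid {δ₀ : ℝ} (hδ₀ : 0 < δ₀) (j : ℕ) {t t' : ℕ}
    (h1 : δ₀ * (t' : ℝ) / 2 ^ j ≤ δ₀ * ((t : ℝ) + 1 / 2) / 2 ^ j)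
    (h2 : δ₀ * ((t : ℝ) + 1 / 2) / 2 ^ j ≤ δ₀ * ((t' : ℝ) + 1) / 2 ^ j) : t' = t := by
  have hp : (0 : ℝ) < 2 ^ j := by positivity
  rw [div_le_div_iff_of_pos_right hp] at h1 h2
  have h1' : (t' : ℝ) ≤ (t : ℝ) + 1 / 2 := le_of_mul_le_mul_left h1 hδ₀
  have h2' : (t : ℝ) + 1 / 2 ≤ (t' : ℝ) + 1 := le_of_mul_le_mul_left h2 hδ₀
  have h3 : (t' : ℝ) < (t : ℝ) + 1 := by linarith
  have h4 : (t : ℝ) < (t' : ℝ) + 1 := by linarith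
  have h3' : t' < t + 1 := by exact_mod_cast h3
  have h4' : t < t' + 1 := by exact_mod_cast h4
  omega

/-- **Every dyadic boundary segment of the square owns a boundary point lying in no other
segment** (its midpoint): so a union of segments misses part of `∂Sq` as soon as one segment is
left out. [folklore] -/
theorem BoxMerging_exists_mem_frontier_mem_seg_unique {δ₀ : ℝ} (hδ₀ : 0 < δ₀) (j : ℕ)
    (a : Fin 4 × Fin (2 ^ j)) :
    ∃ z ∈ frontier {z : ℂ | 0 < z.re ∧ z.re < δ₀ ∧ 0 < z.im ∧ z.im < δ₀},
      z ∈ {z : ℂ | (a.1 = 0 ∧ z.im = 0 ∧ δ₀ * ((a.2 : ℕ) : ℝ) / 2 ^ j ≤ z.re ∧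
          z.re ≤ δ₀ * (((a.2 : ℕ) : ℝ) + 1) / 2 ^ j) ∨
        (a.1 = 1 ∧ z.re = δ₀ ∧ δ₀ * ((a.2 : ℕ) : ℝ) / 2 ^ j ≤ z.im ∧
          z.im ≤ δ₀ * (((a.2 : ℕ) : ℝ) + 1) / 2 ^ j) ∨
        (a.1 = 2 ∧ z.im = δ₀ ∧ δ₀ * ((a.2 : ℕ) : ℝ) / 2 ^ j ≤ z.re ∧
          z.re ≤ δ₀ * (((a.2 : ℕ) : ℝ) + 1) / 2 ^ j) ∨
        (a.1 = 3 ∧ z.re = 0 ∧ δ₀ * ((a.2 : ℕ) : ℝ) / 2 ^ j ≤ z.im ∧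
          z.im ≤ δ₀ * (((a.2 : ℕ) : ℝ) + 1) / 2 ^ j)} ∧
      ∀ a' : Fin 4 × Fin (2 ^ j), z ∈ {z : ℂ | (a'.1 = 0 ∧ z.im = 0 ∧ δ₀ * ((a'.2 : ℕ) : ℝ) / 2 ^ j ≤ z.re ∧
          z.re ≤ δ₀ * (((a'.2 : ℕ) : ℝ) + 1) / 2 ^ j) ∨
        (a'.1 = 1 ∧ z.re = δ₀ ∧ δ₀ * ((a'.2 : ℕ) : ℝ) / 2 ^ j ≤ z.im ∧
          z.im ≤ δ₀ * (((a'.2 : ℕ) : ℝ) + 1) / 2 ^ j) ∨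
        (a'.1 = 2 ∧ z.im = δ₀ ∧ δ₀ * ((a'.2 : ℕ) : ℝ) / 2 ^ j ≤ z.re ∧
          z.re ≤ δ₀ * (((a'.2 : ℕ) : ℝ) + 1) / 2 ^ j) ∨
        (a'.1 = 3 ∧ z.re = 0 ∧ δ₀ * ((a'.2 : ℕ) : ℝ) / 2 ^ j ≤ z.im ∧
          z.im ≤ δ₀ * (((a'.2 : ℕ) : ℝ) + 1) / 2 ^ j)} → a' = a := by
  obtain ⟨s, t⟩ := a
  have hp : (0 : ℝ) < 2 ^ j := by positivity
  have ht1 : ((t : ℕ) : ℝ) + 1 ≤ (2 : ℝ) ^ j := by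
    have h := t.isLt
    exact_mod_cast Nat.succ_le_of_lt h
  have hm0 : 0 < δ₀ * (((t : ℕ) : ℝ) + 1 / 2) / 2 ^ j := by positivity
  have hm1 : δ₀ * (((t : ℕ) : ℝ) + 1 / 2) / 2 ^ j < δ₀ := by
    rw [div_lt_iff₀ hp]; nlinarith
  have hlo : δ₀ * ((t : ℕ) : ℝ) / 2 ^ j ≤ δ₀ * (((t : ℕ) : ℝ) + 1 / 2) / 2 ^ j :=
    div_le_div_of_nonneg_right (by nlinarith) hp.le
  have hhi : δ₀ * (((t : ℕ) : ℝ) + 1 / 2) / 2 ^ j ≤ δ₀ * (((t : ℕ) : ℝ) + 1) / 2 ^ j :=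
    div_le_div_of_nonneg_right (by nlinarith) hp.le
  rw [BoxMerging_frontier_sq hδ₀]
  simp only [mem_union, Complex.mem_reProdIm, mem_Icc, mem_insert_iff, mem_singleton_iff, mem_setOf_eq]
  fin_cases s
  · refine ⟨⟨δ₀ * (((t : ℕ) : ℝ) + 1 / 2) / 2 ^ j, 0⟩, Or.inl ⟨⟨hm0.le, hm1.le⟩, Or.inl rfl⟩,
      Or.inl ⟨rfl, rfl, hlo, hhi⟩, fun a' ha' => ?_⟩
    obtain ⟨s', t'⟩ := a'
    rcases ha' with ⟨hs', h1, h2, h3⟩ | ⟨hs', h1, h2, h3⟩ | ⟨hs', h1, h2, h3⟩ | ⟨hs', h1, h2, h3⟩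
    · exact Prod.ext hs' (Fin.ext (BoxMerging_index_eq_of_mid hδ₀ j h2 h3))
    · dsimp only at h1; linarith
    · dsimp only at h1; linarith
    · dsimp only at h1; linarith
  · refine ⟨⟨δ₀, δ₀ * (((t : ℕ) : ℝ) + 1 / 2) / 2 ^ j⟩, Or.inr ⟨Or.inr rfl, hm0.le, hm1.le⟩,
      Or.inr (Or.inl ⟨rfl, rfl, hlo, hhi⟩), fun a' ha' => ?_⟩
    obtain ⟨s', t'⟩ := a'
    rcases ha' with ⟨hs', h1, h2, h3⟩ | ⟨hs', h1, h2, h3⟩ | ⟨hs', h1, h2, h3⟩ | ⟨hs', h1, h2, h3⟩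
    · dsimp only at h1; linarith
    · exact Prod.ext hs' (Fin.ext (BoxMerging_index_eq_of_mid hδ₀ j h2 h3))
    · dsimp only at h1; linarith
    · dsimp only at h1; linarith
  · refine ⟨⟨δ₀ * (((t : ℕ) : ℝ) + 1 / 2) / 2 ^ j, δ₀⟩, Or.inl ⟨⟨hm0.le, hm1.le⟩, Or.inr rfl⟩,
      Or.inr (Or.inr (Or.inl ⟨rfl, rfl, hlo, hhi⟩)), fun a' ha' => ?_⟩
    obtain ⟨s', t'⟩ := a'
    rcases ha' with ⟨hs', h1, h2, h3⟩ | ⟨hs', h1, h2, h3⟩ | ⟨hs', h1, h2, h3⟩ | ⟨hs', h1, h2, h3⟩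
    · dsimp only at h1; linarith
    · dsimp only at h1; linarith
    · exact Prod.ext hs' (Fin.ext (BoxMerging_index_eq_of_mid hδ₀ j h2 h3))
    · dsimp only at h1; linarith
  · refine ⟨⟨0, δ₀ * (((t : ℕ) : ℝ) + 1 / 2) / 2 ^ j⟩, Or.inr ⟨Or.inl rfl, hm0.le, hm1.le⟩,
      Or.inr (Or.inr (Or.inr ⟨rfl, rfl, hlo, hhi⟩)), fun a' ha' => ?_⟩
    obtain ⟨s', t'⟩ := a'
    rcases ha' with ⟨hs', h1, h2, h3⟩ | ⟨hs', h1, h2, h3⟩ | ⟨hs', h1, h2, h3⟩ | ⟨hs', h1, h2, h3⟩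
    · dsimp only at h1; linarith
    · dsimp only at h1; linarith
    · dsimp only at h1; linarith
    · exact Prod.ext hs' (Fin.ext (BoxMerging_index_eq_of_mid hδ₀ j h2 h3))

/-- A union of dyadic boundary segments of the square over a proper index set leaves out a point
of `∂Sq`. [folklore] -/
theorem BoxMerging_frontier_diff_biUnion_seg_nonempty {δ₀ : ℝ} (hδ₀ : 0 < δ₀) (j : ℕ)
    {I : Finset (Fin 4 × Fin (2 ^ j))} (hI : I ≠ Finset.univ) :
    (frontier {z : ℂ | 0 < z.re ∧ z.re < δ₀ ∧ 0 < z.im ∧ z.im < δ₀} \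
      ⋃ a ∈ I, {z : ℂ | (a.1 = 0 ∧ z.im = 0 ∧ δ₀ * ((a.2 : ℕ) : ℝ) / 2 ^ j ≤ z.re ∧
          z.re ≤ δ₀ * (((a.2 : ℕ) : ℝ) + 1) / 2 ^ j) ∨
        (a.1 = 1 ∧ z.re = δ₀ ∧ δ₀ * ((a.2 : ℕ) : ℝ) / 2 ^ j ≤ z.im ∧
          z.im ≤ δ₀ * (((a.2 : ℕ) : ℝ) + 1) / 2 ^ j) ∨
        (a.1 = 2 ∧ z.im = δ₀ ∧ δ₀ * ((a.2 : ℕ) : ℝ) / 2 ^ j ≤ z.re ∧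
          z.re ≤ δ₀ * (((a.2 : ℕ) : ℝ) + 1) / 2 ^ j) ∨
        (a.1 = 3 ∧ z.re = 0 ∧ δ₀ * ((a.2 : ℕ) : ℝ) / 2 ^ j ≤ z.im ∧
          z.im ≤ δ₀ * (((a.2 : ℕ) : ℝ) + 1) / 2 ^ j)}).Nonempty := by
  obtain ⟨a₀, ha₀⟩ : ∃ a₀, a₀ ∉ I :=
    not_forall.1 fun h => hI (Finset.eq_univ_iff_forall.2 h)
  obtain ⟨z, hzF, -, huniq⟩ := BoxMerging_exists_mem_frontier_mem_seg_unique hδ₀ j a₀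
  refine ⟨z, hzF, fun hz => ?_⟩
  simp only [mem_iUnion, exists_prop] at hz
  obtain ⟨a, haI, hza⟩ := hz
  exact ha₀ (huniq a hza ▸ haI)

/-- **`BoxMerging` ⇒ the crossing events of every dyadic-marked square merge.**  Under
`BoxMerging`, for every side `δ₀ > 0`, resolution `j` and `ε > 0` there is `η > 0` such that for
all meshes `0 < u, u' < η` and all nonempty proper sets `I, J` of dyadic boundary segments of the
square `(0, δ₀)²`, the bond-`ℤ²` probability (mesh `u`) and the
site-`𝕋` probability (mesh `u'`) of an open crossing of the square from `⋃_I seg` to `⋃_J seg`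
differ by at most `ε`.  (`BoxMerging` gives `TV_j ≤ ε/2`; `BoxMerging_abs_bond_sub_tri_le_of_biUnion`
reads both probabilities from the state laws.)  With Smirnov's theorem on `𝕋` this is the
"LimitExists for every dyadic-marked square on `ℤ²`" of the item's informal statement, at the
level of the G02 crossing events. [folklore] -/
theorem BoxMerging_unions_merge (hBM : BoxMerging) {δ₀ : ℝ} (hδ₀ : 0 < δ₀) (j : ℕ) {ε : ℝ}
    (hε : 0 < ε) :
    ∃ η : ℝ, 0 < η ∧ ∀ u u' : ℝ, 0 < u → u < η → 0 < u' → u' < η →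
      ∀ I J : Finset (Fin 4 × Fin (2 ^ j)), I.Nonempty → J.Nonempty →
        I ≠ Finset.univ → J ≠ Finset.univ →
        |(bondPercolation (zdGraph 2) half).real
              (discreteCrossing {z : ℂ | 0 < z.re ∧ z.re < δ₀ ∧ 0 < z.im ∧ z.im < δ₀} u
                (⋃ a ∈ I, {z : ℂ | (a.1 = 0 ∧ z.im = 0 ∧ δ₀ * ((a.2 : ℕ) : ℝ) / 2 ^ j ≤ z.re ∧
                      z.re ≤ δ₀ * (((a.2 : ℕ) : ℝ) + 1) / 2 ^ j) ∨
                    (a.1 = 1 ∧ z.re = δ₀ ∧ δ₀ * ((a.2 : ℕ) : ℝ) / 2 ^ j ≤ z.im ∧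
                      z.im ≤ δ₀ * (((a.2 : ℕ) : ℝ) + 1) / 2 ^ j) ∨
                    (a.1 = 2 ∧ z.im = δ₀ ∧ δ₀ * ((a.2 : ℕ) : ℝ) / 2 ^ j ≤ z.re ∧
                      z.re ≤ δ₀ * (((a.2 : ℕ) : ℝ) + 1) / 2 ^ j) ∨
                    (a.1 = 3 ∧ z.re = 0 ∧ δ₀ * ((a.2 : ℕ) : ℝ) / 2 ^ j ≤ z.im ∧
                      z.im ≤ δ₀ * (((a.2 : ℕ) : ℝ) + 1) / 2 ^ j)})
                (⋃ b ∈ J, {z : ℂ | (b.1 = 0 ∧ z.im = 0 ∧ δ₀ * ((b.2 : ℕ) : ℝ) / 2 ^ j ≤ z.re ∧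
                      z.re ≤ δ₀ * (((b.2 : ℕ) : ℝ) + 1) / 2 ^ j) ∨
                    (b.1 = 1 ∧ z.re = δ₀ ∧ δ₀ * ((b.2 : ℕ) : ℝ) / 2 ^ j ≤ z.im ∧
                      z.im ≤ δ₀ * (((b.2 : ℕ) : ℝ) + 1) / 2 ^ j) ∨
                    (b.1 = 2 ∧ z.im = δ₀ ∧ δ₀ * ((b.2 : ℕ) : ℝ) / 2 ^ j ≤ z.re ∧
                      z.re ≤ δ₀ * (((b.2 : ℕ) : ℝ) + 1) / 2 ^ j) ∨
                    (b.1 = 3 ∧ z.re = 0 ∧ δ₀ * ((b.2 : ℕ) : ℝ) / 2 ^ j ≤ z.im ∧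
                      z.im ≤ δ₀ * (((b.2 : ℕ) : ℝ) + 1) / 2 ^ j)})) -
            (triSitePercolation half).real
              (triCrossing {z : ℂ | 0 < z.re ∧ z.re < δ₀ ∧ 0 < z.im ∧ z.im < δ₀} u'
                (⋃ a ∈ I, {z : ℂ | (a.1 = 0 ∧ z.im = 0 ∧ δ₀ * ((a.2 : ℕ) : ℝ) / 2 ^ j ≤ z.re ∧
                      z.re ≤ δ₀ * (((a.2 : ℕ) : ℝ) + 1) / 2 ^ j) ∨
                    (a.1 = 1 ∧ z.re = δ₀ ∧ δ₀ * ((a.2 : ℕ) : ℝ) / 2 ^ j ≤ z.im ∧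
                      z.im ≤ δ₀ * (((a.2 : ℕ) : ℝ) + 1) / 2 ^ j) ∨
                    (a.1 = 2 ∧ z.im = δ₀ ∧ δ₀ * ((a.2 : ℕ) : ℝ) / 2 ^ j ≤ z.re ∧
                      z.re ≤ δ₀ * (((a.2 : ℕ) : ℝ) + 1) / 2 ^ j) ∨
                    (a.1 = 3 ∧ z.re = 0 ∧ δ₀ * ((a.2 : ℕ) : ℝ) / 2 ^ j ≤ z.im ∧
                      z.im ≤ δ₀ * (((a.2 : ℕ) : ℝ) + 1) / 2 ^ j)})
                (⋃ b ∈ J, {z : ℂ | (b.1 = 0 ∧ z.im = 0 ∧ δ₀ * ((b.2 : ℕ) : ℝ) / 2 ^ j ≤ z.re ∧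
                      z.re ≤ δ₀ * (((b.2 : ℕ) : ℝ) + 1) / 2 ^ j) ∨
                    (b.1 = 1 ∧ z.re = δ₀ ∧ δ₀ * ((b.2 : ℕ) : ℝ) / 2 ^ j ≤ z.im ∧
                      z.im ≤ δ₀ * (((b.2 : ℕ) : ℝ) + 1) / 2 ^ j) ∨
                    (b.1 = 2 ∧ z.im = δ₀ ∧ δ₀ * ((b.2 : ℕ) : ℝ) / 2 ^ j ≤ z.re ∧
                      z.re ≤ δ₀ * (((b.2 : ℕ) : ℝ) + 1) / 2 ^ j) ∨
                    (b.1 = 3 ∧ z.re = 0 ∧ δ₀ * ((b.2 : ℕ) : ℝ) / 2 ^ j ≤ z.im ∧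
                      z.im ≤ δ₀ * (((b.2 : ℕ) : ℝ) + 1) / 2 ^ j)}))| ≤ ε := by
  -- the window and its segments, abbreviated
  set Sq : Set ℂ := {z : ℂ | 0 < z.re ∧ z.re < δ₀ ∧ 0 < z.im ∧ z.im < δ₀} with hSq
  set seg : Fin 4 × Fin (2 ^ j) → Set ℂ := fun a =>
    {z : ℂ | (a.1 = 0 ∧ z.im = 0 ∧ δ₀ * ((a.2 : ℕ) : ℝ) / 2 ^ j ≤ z.re ∧
          z.re ≤ δ₀ * (((a.2 : ℕ) : ℝ) + 1) / 2 ^ j) ∨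
        (a.1 = 1 ∧ z.re = δ₀ ∧ δ₀ * ((a.2 : ℕ) : ℝ) / 2 ^ j ≤ z.im ∧
          z.im ≤ δ₀ * (((a.2 : ℕ) : ℝ) + 1) / 2 ^ j) ∨
        (a.1 = 2 ∧ z.im = δ₀ ∧ δ₀ * ((a.2 : ℕ) : ℝ) / 2 ^ j ≤ z.re ∧
          z.re ≤ δ₀ * (((a.2 : ℕ) : ℝ) + 1) / 2 ^ j) ∨
        (a.1 = 3 ∧ z.re = 0 ∧ δ₀ * ((a.2 : ℕ) : ℝ) / 2 ^ j ≤ z.im ∧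
          z.im ≤ δ₀ * (((a.2 : ℕ) : ℝ) + 1) / 2 ^ j)} with hseg
  obtain ⟨η, hη, hBM'⟩ := hBM δ₀ hδ₀ j (ε / 2) (half_pos hε)
  refine ⟨η, hη, fun u u' hu huη hu' hu'η I J hI hJ hIu hJu => ?_⟩
  have hFI : (frontier Sq \ ⋃ a ∈ I, seg a).Nonempty :=
    BoxMerging_frontier_diff_biUnion_seg_nonempty hδ₀ j hIu
  have hFJ : (frontier Sq \ ⋃ b ∈ J, seg b).Nonempty :=
    BoxMerging_frontier_diff_biUnion_seg_nonempty hδ₀ j hJu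
  have hTV : (1 / 2 : ℝ) * ∑ M : (Fin 4 × Fin (2 ^ j)) → (Fin 4 × Fin (2 ^ j)) → Bool,
      |(bondPercolation (zdGraph 2) half).real
          {ω | ∀ a b, ω ∈ discreteCrossing Sq u (seg a) (seg b) ↔ M a b = true} -
        (triSitePercolation half).real
          {ω | ∀ a b, ω ∈ triCrossing Sq u' (seg a) (seg b) ↔ M a b = true}| ≤ ε / 2 :=
    hBM' u u' hu huη hu' hu'η
  have hSqR : Sq = (rectQuad 0 δ₀ 0 δ₀ hδ₀ hδ₀).carrier := BoxMerging_sq_eq_rectQuad_carrier hδ₀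
  have hbdd : Bornology.IsBounded Sq := hSqR ▸ (rectQuad 0 δ₀ 0 δ₀ hδ₀ hδ₀).isBounded
  have hne : ∀ a, (seg a).Nonempty := fun a => BoxMerging_seg_nonempty hδ₀ j a
  have key := BoxMerging_abs_bond_sub_tri_le_of_biUnion hbdd seg hne hI hJ hFI hFJ u hu'
  show |(bondPercolation (zdGraph 2) half).real
          (discreteCrossing Sq u (⋃ a ∈ I, seg a) (⋃ b ∈ J, seg b)) -
        (triSitePercolation half).real (triCrossing Sq u' (⋃ a ∈ I, seg a) (⋃ b ∈ J, seg b))| ≤ ε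
  linarith

end Summit.CriticalPhenomena.CardyFormulaZ2.Theorems
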